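import Literature.MathematicalPhysics.QuantumLattice.StaggeredPeriodicAntiperiodicEquivalence
import Literature.MathematicalPhysics.QuantumFieldTheory.WilsonEnergyConvexity
import HarnessLib

/-!
# Continuity in the gauge coupling `β` of Wilson-weighted expectations and of the determinant
# representation of the staggered two-point function

[abstract] On a finite torus the Wilson weight `e^{-βS_W(U)} ∏_b dU_b` has a bounded continuous
density with respect to the product Haar measure, so every Haar-integrable observable has an
expectation `β ↦ ∫ g d(wilsonWeight ρ β)` that is continuous in `β ∈ ℝ` (dominated convergence on
the compact configuration space; `continuous_integral_wilsonWeight`).  For `G = U(N)` with massless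
staggered fermions this gives the continuity in `β` of the numerator, the (positive) denominator
and the quotient of the determinant ∕ propagator representation of the two-point function
`(∫ Re det D₀ · Re W_{xy}(D₀⁻¹) d(wilsonWeight ρ β)) / (∫ Re det D₀ d(wilsonWeight ρ β))`
(`continuous_detRep_twoPoint`) — the object of the venture's typed conjecture
`SalmhoferSeilerSmallBeta` — whose numerator integrand is Haar-integrable because it agrees almost
everywhere with the polynomial Berezin integrand (`StaggeredPeriodicAntiperiodicEquivalence`).

[scope] Finite torus, fixed `L`; continuity is in `β` at FIXED volume — nothing here is uniform in
`L`.  Theorems only; no facts, no `sorry`.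

## References
* [SalmhoferSeiler1991] M. Salmhofer, E. Seiler, Commun. Math. Phys. 139 (1991) 395–432, §2 (2.2), (2.9)–(2.12).
* [MontvayMunster1994] I. Montvay, G. Münster, Quantum Fields on a Lattice, CUP 1994, §3.2.
-/

noncomputable section

open MeasureTheory Matrix Complex Finset Filter Topology
open Literature.MathematicalPhysics.QuantumFieldTheory
open Literature.Probability.LatticeModels (TorusSite)
open scoped ComplexConjugate BigOperators

namespace Literature.MathematicalPhysics.QuantumLattice

namespace StaggeredRP

open GrassmannAlgebra StrongCoupling StaggeredSingular

/-! ## 1. Wilson-weighted integrals are continuous in `β` -/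

section General

variable {d L N : ℕ} [NeZero L] {G : Type*} [Group G] [TopologicalSpace G] [IsTopologicalGroup G]
  [CompactSpace G] [MeasurableSpace G] [BorelSpace G] (ρ : G →* Matrix (Fin N) (Fin N) ℂ)

/-- `∫ g d(wilsonWeight ρ β) = ∫ e^{-βS_W(U)} g(U) ∏_b dU_b`. [cite: SalmhoferSeiler1991, §2 (2.2), (2.12)] -/
theorem integral_wilsonWeight_eq_integral_exp_smul {E : Type*} [NormedAddCommGroup E] [NormedSpace ℝ E]
    (hρ : Continuous ρ) (β : ℝ) (g : GaugeConfig d L G → E) :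
    ∫ U, g U ∂(wilsonWeight (d := d) (L := L) ρ β) =
      ∫ U, Real.exp (-β * wilsonAction ρ U) • g U ∂(Measure.pi fun _ : Edge d L => haarProbability G) := by
  rw [wilsonWeight, integral_withDensity_eq_integral_toReal_smul]
  · refine integral_congr_ae (ae_of_all _ fun U => ?_)
    simp only [ENNReal.toReal_ofReal (Real.exp_pos _).le]
  · exact ENNReal.measurable_ofReal.comp (Real.measurable_exp.comp ((WilsonRP.measurable_wilsonAction ρ hρ).const_mul _))
  · exact ae_of_all _ fun _ => ENNReal.ofReal_lt_top

/-- **The Wilson-weighted integral of a Haar-integrable observable is continuous in the coupling**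
`β ∈ ℝ` (dominated convergence: `|S_W| ≤ B` on the compact configuration space). [cite: SalmhoferSeiler1991, §2 (2.2), (2.12)] -/
theorem continuous_integral_wilsonWeight {E : Type*} [NormedAddCommGroup E] [NormedSpace ℝ E] (hρ : Continuous ρ)
    {g : GaugeConfig d L G → E} (hg : Integrable g (Measure.pi fun _ : Edge d L => haarProbability G)) :
    Continuous fun β : ℝ => ∫ U, g U ∂(wilsonWeight (d := d) (L := L) ρ β) := by
  have hfun : (fun β : ℝ => ∫ U, g U ∂(wilsonWeight (d := d) (L := L) ρ β)) = fun β : ℝ =>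
      ∫ U, Real.exp (-β * wilsonAction ρ U) • g U ∂(Measure.pi fun _ : Edge d L => haarProbability G) :=
    funext fun β => integral_wilsonWeight_eq_integral_exp_smul ρ hρ β g
  rw [hfun]
  obtain ⟨B, hB⟩ := exists_abs_wilsonAction_le (d := d) (L := L) ρ hρ
  have hSm : Measurable (wilsonAction (d := d) (L := L) ρ) := WilsonRP.measurable_wilsonAction ρ hρ
  refine continuous_iff_continuousAt.2 fun β₀ => ?_
  refine continuousAt_of_dominated (bound := fun U => Real.exp ((|β₀| + 1) * B) * ‖g U‖) ?_ ?_ ?_ ?_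
  · exact Eventually.of_forall fun β =>
      ((Real.measurable_exp.comp (hSm.const_mul _)).aestronglyMeasurable).smul hg.aestronglyMeasurable
  · have hball : ∀ᶠ β in 𝓝 β₀, |β - β₀| < 1 := by
      filter_upwards [Metric.ball_mem_nhds β₀ one_pos] with β hβ
      rwa [Metric.mem_ball, Real.dist_eq] at hβ
    filter_upwards [hball] with β hβ
    refine ae_of_all _ fun U => ?_
    rw [norm_smul, Real.norm_eq_abs, Real.abs_exp]
    refine mul_le_mul_of_nonneg_right (Real.exp_le_exp.2 ?_) (norm_nonneg _)
    have h2 : |β| ≤ |β₀| + 1 := by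
      have := abs_sub_abs_le_abs_sub β β₀
      linarith
    have hB0 : 0 ≤ B := (abs_nonneg _).trans (hB U)
    calc -β * wilsonAction ρ U ≤ |-β * wilsonAction ρ U| := le_abs_self _
      _ = |β| * |wilsonAction ρ U| := by rw [abs_mul, abs_neg]
      _ ≤ (|β₀| + 1) * B := mul_le_mul h2 (hB U) (abs_nonneg _) (by positivity)
  · exact hg.norm.const_mul _
  · exact ae_of_all _ fun U =>
      ((Real.continuous_exp.comp (continuous_neg.mul continuous_const)).smul continuous_const).continuousAt

end General

/-! ## 2. The determinant representation: integrability and continuity in `β` -/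

section Staggered

variable {d L N : ℕ} [NeZero d] [NeZero L]

/-- The complex numerator integrand `det D₀[U] · W_{xy}(D₀[U]⁻¹)` is integrable for the Wilson weight at
every `β` (it agrees off the Haar-null singular set with the polynomial Berezin integrand). [cite: SalmhoferSeiler1991, §2 (2.9)–(2.12)] -/
theorem integrable_det_mul_wick2_wilsonWeight (hL : Even L) (β : ℝ) (x y : Site d L) :
    Integrable (fun U => (D0 U).det * wick2 (D0 U)⁻¹ x y)
      (wilsonWeight (d := d) (L := L) (unitaryFundamentalRep (Fin N) ℂ) β) := by
  classical
  letI : LinearOrder (Site d L) :=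
    LinearOrder.lift' (Fintype.equivFin (Site d L)) (Fintype.equivFin (Site d L)).injective
  have hL1 : 1 < L := one_lt_of_even_neZero hL
  set s : ℂ := orientationSign (Site d L) N with hs
  have hB : ∀ U, (D0 U).det ≠ 0 →
      (D0 U).det * wick2 (D0 U)⁻¹ x y = s * berezin ℂ _ ((meson x * meson y : FermiAlg (Site d L) N) *
        fermiBoltzmann (torusLinks d L) (stagSigns d L) ((0 : ℝ) : ℂ) U) := by
    intro U hU
    have h := berezin_meson_meson_fermiBoltzmann_torus U hU x y
    rw [det_neg_D0 hL] at h
    rw [← hs] at h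
    rw [h, ← mul_assoc, ← mul_assoc, hs, orientationSign_mul_self, one_mul]
  have hae : (fun U => (D0 U).det * wick2 (D0 U)⁻¹ x y) =ᵐ[wilsonWeight (d := d) (L := L) (unitaryFundamentalRep (Fin N) ℂ) β]
      fun U => s * berezin ℂ _ ((meson x * meson y : FermiAlg (Site d L) N) *
        fermiBoltzmann (torusLinks d L) (stagSigns d L) ((0 : ℝ) : ℂ) U) := by
    filter_upwards [ae_det_D0_ne_zero_wilsonWeight (d := d) (L := L) (N := N) β] with U hU using hB U hU
  exact ((integrable_berezin_meson_meson_wilsonWeight (N := N) hL1 β x y).const_mul s).congr hae.symm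

/-- The real numerator integrand `Re det D₀ · Re W_{xy}(D₀⁻¹)` is integrable for the Wilson weight. [cite: SalmhoferSeiler1991, §2 (2.9)–(2.12)] -/
theorem integrable_detRe_mul_wickRe_wilsonWeight (hL : Even L) (β : ℝ) (x y : Site d L) :
    Integrable (fun U => ((D0 U).det).re * (wick2 (D0 U)⁻¹ x y).re)
      (wilsonWeight (d := d) (L := L) (unitaryFundamentalRep (Fin N) ℂ) β) := by
  refine ((integrable_det_mul_wick2_wilsonWeight (N := N) hL β x y).re).congr (ae_of_all _ fun U => ?_)
  show RCLike.re ((D0 U).det * wick2 (D0 U)⁻¹ x y) = _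
  rw [RCLike.re_eq_complex_re, Complex.mul_re, det_D0_im hL U, zero_mul, sub_zero]

omit [NeZero d] in
/-- The denominator integrand `Re det D₀` is integrable for the Wilson weight. [cite: SalmhoferSeiler1991, §2 (2.11)–(2.12)] -/
theorem integrable_detRe_wilsonWeight (β : ℝ) :
    Integrable (fun U => ((D0 U).det).re) (wilsonWeight (d := d) (L := L) (unitaryFundamentalRep (Fin N) ℂ) β) := by
  haveI := isFiniteMeasure_wilsonWeight (ν := d) (L := L) (N := N) β
  exact continuous_det_D0_re.integrable_of_hasCompactSupport (HasCompactSupport.of_compactSpace _)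

/-- **The numerator `β ↦ ∫ Re det D₀ · Re W_{xy}(D₀⁻¹) d(wilsonWeight ρ β)` is continuous in `β`.** [cite: SalmhoferSeiler1991, §2 (2.9)–(2.12)] -/
theorem continuous_detRep_numerator (hL : Even L) (x y : Site d L) :
    Continuous fun β : ℝ => ∫ U, ((D0 U).det).re * (wick2 (D0 U)⁻¹ x y).re
      ∂(wilsonWeight (d := d) (L := L) (unitaryFundamentalRep (Fin N) ℂ) β) := by
  have h := integrable_detRe_mul_wickRe_wilsonWeight (N := N) hL 0 x y
  rw [wilsonWeight_zero] at h
  exact continuous_integral_wilsonWeight (unitaryFundamentalRep (Fin N) ℂ) continuous_subtype_val h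

omit [NeZero d] in
/-- **The denominator `β ↦ ∫ Re det D₀ d(wilsonWeight ρ β)` is continuous in `β`.** [cite: SalmhoferSeiler1991, §2 (2.11)–(2.12)] -/
theorem continuous_detRep_denominator :
    Continuous fun β : ℝ => ∫ U, ((D0 U).det).re ∂(wilsonWeight (d := d) (L := L) (unitaryFundamentalRep (Fin N) ℂ) β) := by
  have h := integrable_detRe_wilsonWeight (d := d) (L := L) (N := N) 0
  rw [wilsonWeight_zero] at h
  exact continuous_integral_wilsonWeight (unitaryFundamentalRep (Fin N) ℂ) continuous_subtype_val h

/-- **The determinant representation of the massless two-point function is continuous in the coupling**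
`β ∈ ℝ` at fixed volume (even `L`, `d ≥ 1`):
`β ↦ (∫ Re det D₀ · Re W_{xy}(D₀⁻¹) d(wilsonWeight ρ β)) / (∫ Re det D₀ d(wilsonWeight ρ β))`, the
denominator being positive at every `β` (`integral_det_D0_re_wilsonWeight_pos`). [cite: SalmhoferSeiler1991, §2 (2.9)–(2.12)] -/
theorem continuous_detRep_twoPoint (hL : Even L) (x y : Site d L) :
    Continuous fun β : ℝ =>
      (∫ U, ((D0 U).det).re * (wick2 (D0 U)⁻¹ x y).re
          ∂(wilsonWeight (d := d) (L := L) (unitaryFundamentalRep (Fin N) ℂ) β)) /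
        (∫ U, ((D0 U).det).re ∂(wilsonWeight (d := d) (L := L) (unitaryFundamentalRep (Fin N) ℂ) β)) :=
  (continuous_detRep_numerator hL x y).div continuous_detRep_denominator fun β =>
    (integral_det_D0_re_wilsonWeight_pos (N := N) hL β).ne'

end Staggered

end StaggeredRP

end Literature.MathematicalPhysics.QuantumLattice

end
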